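import Summits.AtomisticToContinuum.FouriersLaw.Theses.HeatModeWeylLaw
import HarnessLib

/-!
# Birth skeleton (BC3) for crux `HeatModeGap` — item stmt-AtomisticToContinuum-12393,
# route `HeatModeWeylLaw` (rank 2), sub-problem `FouriersLaw`

Crux BY NAME: `Summit.AtomisticToContinuum.FouriersLaw.Theses.HeatModeWeylLaw.HeatModeGap` —
for `P = pinnedChain ω₂ lam β γ` (all four parameters `> 0`), `T > 0`, the centred Dirichlet sine energy
mode `Ê_N`, its Gibbs variance `V_N` and the equilibrium autocorrelation
`c_N(t) = ∫ Ê_N · (K_t Ê_N) dμ_N` (`K_t = P.transitionKernel N T T t`): there are `A, r > 0`, uniform in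
`N ≥ 1` and `t ≥ 0`, with `c_N(t) ≤ A · e^(−r t / N²) · V_N`.

## The cut: boundary OBSERVABILITY of the evolved heat mode over one diffusive period

Write `g_t := K_t Ê_N` (the evolved centred mode, `x ↦ E_x[Ê_N(X_t)]`), `m_N(t) := ‖g_t‖²_(L²(μ_N))` and
`D_N(u) := Σ_b ∫ (∂_(p_b) g_u)² dμ_N`, the momentum-gradient energy of `g_u` at the two thermostatted
sites `b ∈ {0, N-1}` (both terms sit on site `0` when `N = 1`, exactly as in `OscillatorChain.generator`).
Since `⟨f, L f⟩_μ = −γT Σ_b ‖∂_(p_b) f‖²` for the equilibrium generator `L = A_H + γ Σ_b (T∂²_(p_b) − p_b ∂_(p_b))`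
(the Hamiltonian part is antisymmetric in `L²(μ_T)`), the `L²` mass of the evolved mode is paid out ONLY
through the two bath momenta:

* `stub_dissipationInequality` (S1, regularity / energy inequality, size L): for `t, s ≥ 0`,
  `m_N(t+s) + 2γT ∫_t^(t+s) D_N(u) du ≤ m_N(t)` — the integrated `L²(μ_N)` energy inequality of the
  hypoelliptic equilibrium semigroup on the polynomial observable `Ê_N` (smoothness of `x ↦ E_x[Ê_N(X_u)]`,
  Hörmander/CEHR2018 §3; stated `≤` so that the pointwise `deriv` inside `partialP` can only weaken it).
* `stub_boundaryObservability` (S2, THE OPEN CONTENT, size = the crux): there is `θ ∈ (0,1)`, uniform in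
  `N ≥ 1` and in the start time `t ≥ 0`, with `(1 − θ) m_N(t) ≤ 2γT ∫_t^(t+N²) D_N(u) du` — over ONE
  DIFFUSIVE PERIOD the two boundary momenta observe a fixed fraction of the evolved mode's `L²` mass.
  This is the control-theoretic form (observability inequality ⟺ uniform exponential stabilisation,
  Datko–Pazy) of "anharmonicity sweeps the slow `N⁻³` phonon sector away from the heat mode": for the
  harmonic member the band-edge phonons are NOT observable from the ends in time `N²` with an `N`-uniform
  constant (BeckerMenegaki2022 `λ_S ≍ N⁻³`), so S2 is false at `lam = β = 0`, as the crux must be.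
* `stub_evolvedModeL2` (S3, infrastructure, size M): `m_N(t) ≤ V_N` (Jensen for the Markov kernel `K_t`
  plus invariance of `μ_N`, the CLOSED item `GibbsKernelInvariant`) and Cauchy–Schwarz
  `c_N(t) ≤ √V_N · √m_N(t)` (incl. `K_t Ê_N ∈ L²(μ_N)`; `Ê_N ∈ L²` is the CLOSED item `SineModeBasics`).

Composition `HeatModeGap_of` is a real proof (pure real analysis, `geometric_decay`): S1 at `s = N²` and S2
give the one-period contraction `m_N(t + N²) ≤ θ · m_N(t)`; iterating over `⌊t/N²⌋` periods from the
offset `t − ⌊t/N²⌋N² ∈ [0, N²)` (where S3 gives `m ≤ V_N`) yields `m_N(t) ≤ θ^⌊t/N²⌋ V_N`, and S3's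
Cauchy–Schwarz turns this into `c_N(t) ≤ θ^(⌊t/N²⌋/2) V_N ≤ (1/θ) · e^(−(log(1/θ)/2) t/N²) · V_N`, i.e. the
crux with `A = 1/θ`, `r = log(1/θ)/2`.

## Disproof / refuter record honoured

No `Disproof.lean` exists for this crux (`ledger crux ls`: no workfiles before this one). The item carries a
refuter MISSTATEMENT flag (rattack-12393-0, g45-45, g45-30, g45-48, 2026-08-15; class `misstated`, no ¬-theorem
possible): the literal `∀ N ≥ 1, ∀ t ≥ 0` form with `N`-uniform `(A, r)` constrains the FIXED-`N` asymptotic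
rate (`inf_N N²ρ_N ≥ r`), which rare bath-shielded bulk breathers are argued to violate; recommended repair
`HeatModeGapEv` (diffusive clock, eventually in `N`). This skeleton concludes the crux AS FILED (the decl is
the route's; a registrar does not restate it) and ISOLATES the contested strength: it enters only through the
start-time uniformity "`∀ t ≥ 0`" of S2 (observability of the LATE evolved mode `g_t`, `t ≫ N²`, is exactly
what a shielded long-lived component would break); S1 and S3 are insensitive to it, and S2 restricted to
start times `t ≤ N² s₀` is what the repaired `HeatModeGapEv` would consume. Stub probes (BC3): for each stub,
`stub → HeatModeGap` and `stub → FouriersLaw` by `first | exact? | simpa | aesop` fail (files `bc/probe3_*`).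

r3 (2026-08-17): vocabulary as `let`-free definitions (`modeE`, `centredMode`, `modeVar`, `modeCorr`,
`evolvedMode`, `modeL2`, `bathDissipation`), pinned to the route decl by `crux_iff : CruxViaModes ↔ HeatModeGap :=
Iff.rfl`, so that the registered stub signatures are recorded in full; hypotheses of `HeatModeGap_of` are keyed
by the registered stub names (`Registered.stub_*`), as in `Cruxes/IncoherentChannel/Lines/forgetting_before_hearing.lean`.
-/
namespace Summit.AtomisticToContinuum.FouriersLaw.Cruxes.HeatModeGap.Birth

noncomputable section

open scoped BigOperators Topology Classical MeasureTheory ProbabilityTheory NNReal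
open Filter Set Function MeasureTheory
open Literature.MathematicalPhysics.KineticTheory.HeatConduction

/-! ## Vocabulary (plain functions of the parameters; NO new structure is posited — everything is the
crux's own `let`-bound objects written as definitions over the CONSTRUCTED `pinnedChain`,
`OscillatorChain.gibbsMeasure`, `OscillatorChain.transitionKernel`, and `partialP`) -/

variable (ω₂ lam β γ : ℝ) (T : ℝ)

/-- Equilibrium Gibbs measure `μ_N` of the `N`-site pinned chain at temperature `T`. -/
abbrev μ (N : ℕ) : Measure (PhaseSpace N) := (pinnedChain ω₂ lam β γ).gibbsMeasure N T

/-- Equal-temperature transition kernel `K_t(x, ·)` (real time `t`, clamped by `toNNReal` as in the crux). -/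
abbrev K (N : ℕ) (t : ℝ) (x : PhaseSpace N) : Measure (PhaseSpace N) :=
  (pinnedChain ω₂ lam β γ).transitionKernel N T T t.toNNReal x

/-- The Dirichlet (`k = 1`) sine energy mode `E_N` — verbatim the crux's `e`. -/
def modeE (N : ℕ) (x : PhaseSpace N) : ℝ :=
  (∑ i : Fin N, Real.sin (Real.pi * ((i : ℝ) + 1 / 2) / N) * (x.2 i ^ 2 / 2 + (pinnedChain ω₂ lam β γ).U (x.1 i))) +
    ∑ i : Fin N, ∑ j : Fin N, (if j.val = i.val + 1 then
      (Real.sin (Real.pi * ((i : ℝ) + 1 / 2) / N) + Real.sin (Real.pi * ((j : ℝ) + 1 / 2) / N)) / 2 *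
        (pinnedChain ω₂ lam β γ).V (x.1 j - x.1 i) else 0)

/-- The centred mode `Ê_N = E_N − ∫ E_N dμ_N`. -/
def centredMode (N : ℕ) (x : PhaseSpace N) : ℝ :=
  modeE ω₂ lam β γ N x - ∫ y, modeE ω₂ lam β γ N y ∂(μ ω₂ lam β γ T N)

/-- Gibbs variance `V_N = ∫ Ê_N² dμ_N` — verbatim the crux's `V`. -/
def modeVar (N : ℕ) : ℝ := ∫ x, (centredMode ω₂ lam β γ T N x) ^ 2 ∂(μ ω₂ lam β γ T N)

/-- Autocorrelation `c_N(t) = ∫ Ê_N · (K_t Ê_N) dμ_N` — verbatim the crux's `c`. -/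
def modeCorr (N : ℕ) (t : ℝ) : ℝ :=
  ∫ x, centredMode ω₂ lam β γ T N x * (∫ y, centredMode ω₂ lam β γ T N y ∂(K ω₂ lam β γ T N t x))
    ∂(μ ω₂ lam β γ T N)

/-- The EVOLVED centred mode `g_t = K_t Ê_N`, `x ↦ E_x[Ê_N(X_t)]`. -/
def evolvedMode (N : ℕ) (t : ℝ) (x : PhaseSpace N) : ℝ :=
  ∫ y, centredMode ω₂ lam β γ T N y ∂(K ω₂ lam β γ T N t x)

/-- `m_N(t) = ‖K_t Ê_N‖²` in `L²(μ_N)`. -/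
def modeL2 (N : ℕ) (t : ℝ) : ℝ := ∫ x, (evolvedMode ω₂ lam β γ T N t x) ^ 2 ∂(μ ω₂ lam β γ T N)

/-- Boundary momentum-gradient energy of the evolved mode, `D_N(u) = Σ_b ∫ (∂_(p_b) g_u)² dμ_N` over the
two thermostatted sites `b = 0, N-1` (both terms on site `0` when `N = 1`, as in `OscillatorChain.generator`). -/
def bathDissipation (N : ℕ) (u : ℝ) : ℝ :=
  ∫ x, (∑ i : Fin N,
    ((if i.val = 0 then (partialP i (evolvedMode ω₂ lam β γ T N u) x) ^ 2 else 0) +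
      (if i.val = N - 1 then (partialP i (evolvedMode ω₂ lam β γ T N u) x) ^ 2 else 0))) ∂(μ ω₂ lam β γ T N)

/-- The crux written through the vocabulary (NOT a new statement: `crux_iff` is `Iff.rfl`). -/
def CruxViaModes : Prop :=
    ∀ ω₂ lam β γ : ℝ, 0 < ω₂ → 0 < lam → 0 < β → 0 < γ → ∀ T : ℝ, 0 < T →
      ∃ A r : ℝ, 0 < A ∧ 0 < r ∧ ∀ N : ℕ, 1 ≤ N → ∀ t : ℝ, 0 ≤ t →
        modeCorr ω₂ lam β γ T N t ≤ A * Real.exp (-(r * t / (N : ℝ) ^ 2)) * modeVar ω₂ lam β γ T N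

/-- The vocabulary is pinned to the route decl DEFINITIONALLY. -/
theorem crux_iff : CruxViaModes ↔ Summit.AtomisticToContinuum.FouriersLaw.Theses.HeatModeWeylLaw.HeatModeGap := Iff.rfl

/-! ## The three statements of the line -/

/-- **(S1) `DissipationInequality`** — integrated `L²(μ_N)` energy inequality of the evolved mode:
over `[t, t+s]` the squared norm `m_N` loses at least `2γT ∫_t^(t+s) D_N(u) du` through the two bath momenta
(`⟨f, Lf⟩_μ = −γT Σ_b ‖∂_(p_b) f‖²`, Hamiltonian part antisymmetric); stated `≤` so that the pointwise
`deriv` in `partialP` and Bochner junk values can only weaken it. Size L (smoothness of `x ↦ E_x[Ê_N(X_u)]`). -/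
def DissipationInequality : Prop :=
    ∀ ω₂ lam β γ : ℝ, 0 < ω₂ → 0 < lam → 0 < β → 0 < γ → ∀ T : ℝ, 0 < T →
      ∀ N : ℕ, 1 ≤ N → ∀ t : ℝ, 0 ≤ t → ∀ s : ℝ, 0 ≤ s →
        modeL2 ω₂ lam β γ T N (t + s) + 2 * γ * T * (∫ u in t..(t + s), bathDissipation ω₂ lam β γ T N u) ≤
          modeL2 ω₂ lam β γ T N t

/-- **(S2) `BoundaryObservability`** — THE OPEN CONTENT: an `N`- and start-time-uniform observability
inequality for the evolved heat mode from the two thermostatted momenta over ONE DIFFUSIVE PERIOD `[t, t+N²]`.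
False for the harmonic member (band-edge phonons, the `N⁻³` sector); the `∀ t` uniformity is where the
refuters' shielded-breather objection to the literal crux bites. Size = the crux. -/
def BoundaryObservability : Prop :=
    ∀ ω₂ lam β γ : ℝ, 0 < ω₂ → 0 < lam → 0 < β → 0 < γ → ∀ T : ℝ, 0 < T →
      ∃ θ : ℝ, 0 < θ ∧ θ < 1 ∧ ∀ N : ℕ, 1 ≤ N → ∀ t : ℝ, 0 ≤ t →
        (1 - θ) * modeL2 ω₂ lam β γ T N t ≤ 2 * γ * T * (∫ u in t..(t + (N : ℝ) ^ 2), bathDissipation ω₂ lam β γ T N u)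

/-- **(S3) `EvolvedModeL2`** — `L²` bookkeeping: `m_N(t) ≤ V_N` (Jensen for the Markov kernel + Gibbs
invariance, closed item `GibbsKernelInvariant`) and Cauchy–Schwarz `c_N(t) ≤ √V_N √m_N(t)` (incl.
`K_t Ê_N ∈ L²(μ_N)`; `Ê_N ∈ L²` is the closed item `SineModeBasics`). Size M. -/
def EvolvedModeL2 : Prop :=
    ∀ ω₂ lam β γ : ℝ, 0 < ω₂ → 0 < lam → 0 < β → 0 < γ → ∀ T : ℝ, 0 < T →
      ∀ N : ℕ, 1 ≤ N → ∀ t : ℝ, 0 ≤ t →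
        modeL2 ω₂ lam β γ T N t ≤ modeVar ω₂ lam β γ T N ∧
          modeCorr ω₂ lam β γ T N t ≤ Real.sqrt (modeVar ω₂ lam β γ T N) * Real.sqrt (modeL2 ω₂ lam β γ T N t)

/-! ## The registered stubs (`sorry` lives only in these three theorems; signatures spelled out verbatim,
`let`-free so that the skeleton registry records them in full) -/

/-- **STUB 1 · `stub_dissipationInequality`** (= `DissipationInequality` verbatim).
[CuneoEckmannHairerReyBellet2018 §3; Villani2009; HerauHitrikSjostrand2011 §3.1] -/
theorem stub_dissipationInequality :
    ∀ ω₂ lam β γ : ℝ, 0 < ω₂ → 0 < lam → 0 < β → 0 < γ → ∀ T : ℝ, 0 < T →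
      ∀ N : ℕ, 1 ≤ N → ∀ t : ℝ, 0 ≤ t → ∀ s : ℝ, 0 ≤ s →
        modeL2 ω₂ lam β γ T N (t + s) + 2 * γ * T * (∫ u in t..(t + s), bathDissipation ω₂ lam β γ T N u) ≤
          modeL2 ω₂ lam β γ T N t := by
  sorry

/-- **STUB 2 · `stub_boundaryObservability`** (= `BoundaryObservability` verbatim; the load-bearing stub).
[BeckerMenegaki2022, Menegaki2020, LuYau1993, Villani2009,
Literature.Barriers.AtomisticToContinuum.equilibrium_rate_bound] -/
theorem stub_boundaryObservability :
    ∀ ω₂ lam β γ : ℝ, 0 < ω₂ → 0 < lam → 0 < β → 0 < γ → ∀ T : ℝ, 0 < T →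
      ∃ θ : ℝ, 0 < θ ∧ θ < 1 ∧ ∀ N : ℕ, 1 ≤ N → ∀ t : ℝ, 0 ≤ t →
        (1 - θ) * modeL2 ω₂ lam β γ T N t ≤ 2 * γ * T * (∫ u in t..(t + (N : ℝ) ^ 2), bathDissipation ω₂ lam β γ T N u) := by
  sorry

/-- **STUB 3 · `stub_evolvedModeL2`** (= `EvolvedModeL2` verbatim). [EthierKurtz1986,
CuneoEckmannHairerReyBellet2018] -/
theorem stub_evolvedModeL2 :
    ∀ ω₂ lam β γ : ℝ, 0 < ω₂ → 0 < lam → 0 < β → 0 < γ → ∀ T : ℝ, 0 < T →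
      ∀ N : ℕ, 1 ≤ N → ∀ t : ℝ, 0 ≤ t →
        modeL2 ω₂ lam β γ T N t ≤ modeVar ω₂ lam β γ T N ∧
          modeCorr ω₂ lam β γ T N t ≤ Real.sqrt (modeVar ω₂ lam β γ T N) * Real.sqrt (modeL2 ω₂ lam β γ T N t) := by
  sorry

/-! ### Consistency: each named statement IS its registered stub (definitionally) -/

theorem dissipationInequality_holds : DissipationInequality := stub_dissipationInequality
theorem boundaryObservability_holds : BoundaryObservability := stub_boundaryObservability
theorem evolvedModeL2_holds : EvolvedModeL2 := stub_evolvedModeL2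

/-! ### Name-keyed aliases of the three statements (the hypotheses of the composition) -/
namespace Registered

/-- Alias of `DissipationInequality` keyed by the registered stub name. -/
abbrev stub_dissipationInequality : Prop := DissipationInequality
/-- Alias of `BoundaryObservability` keyed by the registered stub name. -/
abbrev stub_boundaryObservability : Prop := BoundaryObservability
/-- Alias of `EvolvedModeL2` keyed by the registered stub name. -/
abbrev stub_evolvedModeL2 : Prop := EvolvedModeL2

end Registered

/-! ## Proved glue -/

/-- `m_N(t) ≥ 0` (it is `∫ g_t² dμ_N`). -/
theorem modeL2_nonneg (N : ℕ) (t : ℝ) : 0 ≤ modeL2 ω₂ lam β γ T N t :=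
  integral_nonneg fun _ => sq_nonneg _

/-- Pure real analysis behind the composition: a one-period contraction `m (t + L) ≤ θ m t` with
`m ≤ V` and `c ≤ √V √m` forces `c t ≤ (1/θ) e^(−(log(1/θ)/2) t / L) V`. [folklore] -/
theorem geometric_decay {m c : ℝ → ℝ} {V θ L : ℝ} (hθ0 : 0 < θ) (hθ1 : θ < 1) (hL : 0 < L)
    (hcon : ∀ t : ℝ, 0 ≤ t → m t ≤ V)
    (hcs : ∀ t : ℝ, 0 ≤ t → c t ≤ Real.sqrt V * Real.sqrt (m t))
    (hm0 : ∀ t : ℝ, 0 ≤ t → 0 ≤ m t)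
    (hstep : ∀ t : ℝ, 0 ≤ t → m (t + L) ≤ θ * m t) :
    ∀ t : ℝ, 0 ≤ t → c t ≤ 1 / θ * Real.exp (-(-Real.log θ / 2 * t / L)) * V := by
  -- iterate the one-period contraction
  have iter : ∀ k : ℕ, ∀ τ : ℝ, 0 ≤ τ → m (τ + k * L) ≤ θ ^ k * m τ := by
    intro k
    induction k with
    | zero =>
      intro τ hτ
      simp
    | succ k ih =>
      intro τ hτ
      have h1 : 0 ≤ τ + k * L := by positivity
      have e : τ + ((k + 1 : ℕ) : ℝ) * L = τ + k * L + L := by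
        push_cast
        ring
      rw [e]
      calc m (τ + k * L + L) ≤ θ * m (τ + k * L) := hstep _ h1
        _ ≤ θ * (θ ^ k * m τ) := mul_le_mul_of_nonneg_left (ih τ hτ) hθ0.le
        _ = θ ^ (k + 1) * m τ := by ring
  intro t ht
  have hV : 0 ≤ V := le_trans (hm0 t ht) (hcon t ht)
  have hlog : Real.log θ < 0 := Real.log_neg hθ0 hθ1
  set k : ℕ := ⌊t / L⌋₊ with hk
  have hkle : (k : ℝ) ≤ t / L := Nat.floor_le (by positivity)
  have hklt : t / L < (k : ℝ) + 1 := Nat.lt_floor_add_one _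
  have hkL : (k : ℝ) * L ≤ t := by rwa [le_div_iff₀ hL] at hkle
  have hτ0 : 0 ≤ t - k * L := by linarith
  have ht' : t - k * L + k * L = t := by ring
  have hθk : 0 ≤ θ ^ k := pow_nonneg hθ0.le k
  -- `m t ≤ θ^k V`
  have hm1 : m t ≤ θ ^ k * V := by
    have h := iter k (t - k * L) hτ0
    rw [ht'] at h
    exact h.trans (mul_le_mul_of_nonneg_left (hcon _ hτ0) hθk)
  -- Cauchy–Schwarz: `c t ≤ √(θ^k) V`
  have hc1 : c t ≤ Real.sqrt (θ ^ k) * V := by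
    calc c t ≤ Real.sqrt V * Real.sqrt (m t) := hcs t ht
      _ ≤ Real.sqrt V * Real.sqrt (θ ^ k * V) :=
          mul_le_mul_of_nonneg_left (Real.sqrt_le_sqrt hm1) (Real.sqrt_nonneg V)
      _ = Real.sqrt (θ ^ k) * V := by
          rw [Real.sqrt_mul hθk, mul_left_comm, Real.mul_self_sqrt hV]
  -- `√(θ^k) ≤ (1/θ) e^(-(r t / L))` with `r = log(1/θ)/2`, because `k > t/L - 1`
  have hsq : Real.sqrt (θ ^ k) = Real.exp (k * Real.log θ / 2) := by
    rw [Real.exp_half, Real.exp_nat_mul, Real.exp_log hθ0]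
  have h1θ : 1 / θ = Real.exp (-Real.log θ) := by
    rw [Real.exp_neg, Real.exp_log hθ0, one_div]
  have hiv : Real.sqrt (θ ^ k) ≤ 1 / θ * Real.exp (-(-Real.log θ / 2 * t / L)) := by
    rw [hsq, h1θ, ← Real.exp_add, Real.exp_le_exp]
    have e1 : -(-Real.log θ / 2 * t / L) = Real.log θ * (t / L) / 2 := by ring
    rw [e1]
    have hprod := mul_lt_mul_of_neg_left hklt hlog
    linarith
  exact hc1.trans (mul_le_mul_of_nonneg_right hiv hV)

/-- **Composition (kernel-checked, sorry-free): S1 ∧ S2 ∧ S3 ⟹ the crux `HeatModeGap` BY NAME.**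
S1 at `s = N²` and S2 give `m_N(t + N²) ≤ θ m_N(t)`; `geometric_decay` (iteration over `⌊t/N²⌋` periods,
S3's contraction at the offset and S3's Cauchy–Schwarz) gives the crux with `A = 1/θ`, `r = log(1/θ)/2`;
`crux_iff` (`Iff.rfl`) transports it to the route decl. -/
theorem HeatModeGap_of (h1 : Registered.stub_dissipationInequality)
    (h2 : Registered.stub_boundaryObservability) (h3 : Registered.stub_evolvedModeL2) :
    Summit.AtomisticToContinuum.FouriersLaw.Theses.HeatModeWeylLaw.HeatModeGap := by
  refine crux_iff.mp ?_
  intro ω₂ lam β γ hω hl hβ hγ T hT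
  obtain ⟨θ, hθ0, hθ1, hobs⟩ := h2 ω₂ lam β γ hω hl hβ hγ T hT
  have k1 := h1 ω₂ lam β γ hω hl hβ hγ T hT
  have k3 := h3 ω₂ lam β γ hω hl hβ hγ T hT
  have hlog : Real.log θ < 0 := Real.log_neg hθ0 hθ1
  refine ⟨1 / θ, -Real.log θ / 2, by positivity, by linarith, ?_⟩
  intro N hN t ht
  have hNpos : (0 : ℝ) < N := Nat.cast_pos.mpr hN
  have hL : (0 : ℝ) < (N : ℝ) ^ 2 := by positivity
  exact geometric_decay hθ0 hθ1 hL (fun s hs => (k3 N hN s hs).1) (fun s hs => (k3 N hN s hs).2)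
    (fun s _ => modeL2_nonneg ω₂ lam β γ T N s)
    (fun s hs => by
      have a := k1 N hN s hs ((N : ℝ) ^ 2) hL.le
      have b := hobs N hN s hs
      linarith) t ht

/-- The same composition with the three statements spelled out by name (BC3 shape `stub-sigs → crux`). -/
theorem HeatModeGap_of_statements :
    DissipationInequality → BoundaryObservability → EvolvedModeL2 →
    Summit.AtomisticToContinuum.FouriersLaw.Theses.HeatModeWeylLaw.HeatModeGap :=
  fun h1 h2 h3 => HeatModeGap_of h1 h2 h3

/-- Wiring check: the registered stubs feed `HeatModeGap_of` as stated (sorry enters only via the stubs). -/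
example : Summit.AtomisticToContinuum.FouriersLaw.Theses.HeatModeWeylLaw.HeatModeGap :=
  HeatModeGap_of stub_dissipationInequality stub_boundaryObservability stub_evolvedModeL2

end

end Summit.AtomisticToContinuum.FouriersLaw.Cruxes.HeatModeGap.Birth
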